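import Summits.Ventures.CertifiedArithmetic.LowPrec.DoubleRoundingSqrtUnderflowStrip

/-!
# Below the underflow clause of the square root, V: the capture data of a slip

HONEST FRAMING: certified error envelopes and provably optimal rounding/accumulation schemes for
low-precision formats under stated cost models; every table by two implementations; no hardware or
vendor claims. "Square root in format `ψ`" is the correctly rounded square root of the record `ψ`
as a mathematical function (`roundNESqrt`, `RoundSqrt.lean`).

Support file of THEOREM D-sqrt-T (`DoubleRoundingSqrtThreshold.lean`: the exact depth threshold
of `DRSqrt φ ψ` for sources of every bias, which closes the window left open between THEOREM
D-sqrt-U′ `d ≥ m + 3` and LAW N-sqrt-U′ `d ≤ m + 2 - ⌈(bias-2)/2⌉` of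
`DoubleRoundingSqrtUnderflow*.lean`). The anatomy `drSqrt_pos_low` of THEOREM D-sqrt-U′ ends in
a contradiction with its depth hypothesis; here the SAME anatomy is run to its integer end and
the data of the slip are RETURNED (`sqrt_slip_capture`): under `F_φ ⊆ F_ψ`, `P_ψ ≥ 2P_φ + 2`,
`m_φ ≥ 1`, `quantum_φ = 2^d quantum_ψ` with `d ≥ 1`, a slip `fl_φ (fl_ψ x) ≠ fl_φ x` at the
`ψ`-surrogate `x` of `√a` (`a > 0` a value of `φ`) forces, in units of `ν = quantum_ψ / 2`,
a midpoint `M = (2V+1) 2^G` of `φ` SUBNORMAL in `ψ` (a normal one is refuted by `sqrt_slip_core`)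
and an operand `Z = A 2^κ` with

* `d ≤ G ≤ m + 2` (`G = g + d`, `g` the binade of the midpoint in `φ`; `sqrt_low_core`),
  `V < 2^(m+1)`, `1 ≤ A < 2^(m+1)`;
* `κ ≥ 2d + 1 + bias_φ + m` (the operand is `A 2^α` quanta of `φ`, `α ≥ 0`, and
  `quantum_φ = 2^(2d + 1 + bias_φ + m) ν²`) and `κ ≤ 2m + 4 + 2G` (`Z ≤ (M+1)² ≤ 4^(m+2+G)`);
* the CAPTURE `(M-1)² ≤ Z ≤ (M+1)²`, `Z ≠ M²` (correct rounding in `ψ` at spacing `2ν`).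

So whether a slip exists below the depth clause is a question about finitely many integers per
trailing-significand width `m`: THEOREM D-sqrt-T decides it by a kernel table in `m` and reads
the bias and the depth off `κ`. [this packet; cite: Figueroa1995; Roux2014, Thm 25]
-/

namespace Summit.Ventures.CertifiedArithmetic

open Literature.ComputerArithmetic.FloatingPoint
open Literature.ComputerArithmetic.FloatingPoint.Format
open Literature.ComputerArithmetic.FloatingPoint.MiniFloat

/-! ## §1 The anatomy of a slip, run to its integer end -/

/-- THE CAPTURE DATA OF A SLIP (the anatomy of `drSqrt_pos_low` with its conclusion returned
instead of contradicted). Records `F_φ ⊆ F_ψ` (`embedsTest`), `P_ψ ≥ 2P_φ + 2`, `m_φ ≥ 1`,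
`L_ψ < L_φ` (`quantum_φ = 2^d quantum_ψ`, `d = (L_φ - L_ψ).toNat ≥ 1`); `x` the half-quantum
surrogate of `√a` in `ψ` for a value `a > 0` of `φ`. If `fl_φ (fl_ψ x) ≠ fl_φ x` then there are
`G V A κ : ℕ` with `d ≤ G ≤ m + 2`, `V < 2^(m+1)`, `1 ≤ A < 2^(m+1)`,
`2d + 1 + bias_φ + m ≤ κ ≤ 2m + 4 + 2G` and, for `M = (2V+1) 2^G`, `Z = A 2^κ`:
`(M-1)² ≤ Z ≤ (M+1)²`, `Z ≠ M²` (all in units of `quantum_ψ / 2`: `fl_ψ x = M ν` is a midpoint of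
`φ` subnormal in `ψ`, `a = Z ν²`). A midpoint normal in `ψ` is impossible (`sqrt_slip_core`, where
`P_ψ ≥ 2P_φ + 2` is used). [this packet; cite: Figueroa1995; Roux2014, Thm 25] -/
theorem sqrt_slip_capture {φ ψ : Format} (hE : embedsTest φ ψ = true)
    (hm : 2 * φ.manBits + 3 ≤ ψ.manBits) (h1 : 1 ≤ φ.manBits) (hq1 : ψ.qexp + 1 ≤ φ.qexp)
    {a : MiniFloat φ} (ha : 0 < a.toRat) {x : ℚ} {n : ℕ}
    (hxn : (x = n * (ψ.quantum / 2) ∧ ((n : ℚ) * (ψ.quantum / 2)) ^ 2 = a.toRat) ∨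
      (x = ((n : ℚ) + 1 / 2) * (ψ.quantum / 2) ∧ ((n : ℚ) * (ψ.quantum / 2)) ^ 2 < a.toRat ∧
        a.toRat < (((n : ℚ) + 1) * (ψ.quantum / 2)) ^ 2))
    (h : (roundNE φ (roundNE ψ x).toRat).toRat ≠ (roundNE φ x).toRat) :
    ∃ G V A κ : ℕ, (φ.qexp - ψ.qexp).toNat ≤ G ∧ G ≤ φ.manBits + 2 ∧
      V < 2 ^ (φ.manBits + 1) ∧ 1 ≤ A ∧ A < 2 ^ (φ.manBits + 1) ∧
      2 * (φ.qexp - ψ.qexp).toNat + 1 + φ.bias + φ.manBits ≤ κ ∧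
      κ ≤ 2 * φ.manBits + 4 + 2 * G ∧
      ((2 * (V : ℤ) + 1) * 2 ^ G - 1) ^ 2 ≤ (A : ℤ) * 2 ^ κ ∧
      (A : ℤ) * 2 ^ κ ≤ ((2 * (V : ℤ) + 1) * 2 ^ G + 1) ^ 2 ∧
      (A : ℤ) * 2 ^ κ ≠ ((2 * (V : ℤ) + 1) * 2 ^ G) ^ 2 := by
  have hQφ := φ.quantum_pos; have hQ := ψ.quantum_pos
  set ν : ℚ := ψ.quantum / 2 with hνdef
  have hν : 0 < ν := by positivity
  have hx : 0 < x := by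
    rcases hxn with ⟨hx, hsq⟩ | ⟨hx, -, -⟩
    · rw [hx]
      rcases (show (0:ℚ) ≤ n * ν by positivity).eq_or_lt with h0 | h0
      · rw [← h0] at hsq; simp at hsq; linarith
      · exact h0
    · rw [hx]; positivity
  have hq : ψ.qexp ≤ φ.qexp := by omega
  obtain ⟨zM, hzM⟩ := exists_toRat_eq_maxRat_of_test hE
  have hmax : φ.maxRat ≤ ψ.maxRat := hzM ▸ (le_abs_self _).trans (abs_toRat_le_maxRat zM)
  -- the slip anatomy in `φ`: `fl_ψ x = m = (v+u)/2`, `u = v + G`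
  obtain ⟨v, u, hv0, hvx, hxu, hgap, hmid, hxm⟩ :=
    slip_midpoint_of_pos_of_qexp_lt (by omega) hq1 hmax hx h
  set y := roundNE ψ x with hydef
  obtain ⟨u', hu'⟩ := exists_toRat_eq_add_ulp hv0 (hvx.trans hxu)
  have hule := add_ulp_le_of_lt hv0 (hvx.trans hxu)
  have hGpos : (0:ℚ) < 2 ^ (v.expCode - 1) * φ.quantum := by positivity
  have hueq : u.toRat = v.toRat + 2 ^ (v.expCode - 1) * φ.quantum := by
    rcases hgap u' with h1 | h1 <;> linarith
  have hutop : u.toRat ≤ 2 ^ (φ.manBits + 1 + (v.expCode - 1)) * φ.quantum :=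
    hueq ▸ toRat_add_ulp_le hv0
  have hyu : y.toRat < u.toRat := by rw [hmid]; linarith
  have hy0 : 0 < y.toRat := by rw [hmid]; linarith
  -- quanta: `quantum φ = 2^D quantum ψ`, `quantum ψ = 2 ν`, `2^W ν = 1`
  set D := (φ.qexp - ψ.qexp).toNat with hDdef
  have hDq : φ.quantum = 2 ^ D * ψ.quantum := quantum_eq_two_pow_mul hq
  have hD0 : ((D : ℕ) : ℤ) = φ.qexp - ψ.qexp := Int.toNat_of_nonneg (by omega)
  have hQν : ψ.quantum = 2 * ν := by rw [hνdef]; ring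
  have hqφ1 : φ.qexp ≤ 1 := by unfold Format.qexp; omega
  have hqψ1 : ψ.qexp ≤ 1 := by omega
  set W := (1 - ψ.qexp).toNat with hWdef
  have hW0 : ((W : ℕ) : ℤ) = 1 - ψ.qexp := Int.toNat_of_nonneg (by omega)
  have hWν : (2:ℚ) ^ W * ν = 1 := by
    rw [hνdef]; unfold Format.quantum
    rw [← zpow_natCast, hW0, mul_div_assoc', ← zpow_add₀ two_ne_zero, sub_add_cancel, zpow_one,
      div_self two_ne_zero]
  -- the midpoint in units of `ν`: `m = M ν`, `M = (2V'+1) 2^g`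
  have hyQ : y.toRat = (y.scaledMag : ℚ) * ψ.quantum := by
    rw [toRat_eq_toInt_mul, toInt_eq_scaledMag_of_nonneg hy0.le]; push_cast; rfl
  have hvQ : v.toRat = (v.scaledMag : ℚ) * φ.quantum := by
    rw [toRat_eq_toInt_mul, toInt_eq_scaledMag_of_nonneg hv0]; push_cast; rfl
  obtain ⟨V', hV'⟩ := pow_ulpExp_dvd_scaledMag v
  set g := (v.expCode - 1) + D with hgdef
  set M : ℤ := 2 * (y.scaledMag : ℤ) with hMdef
  have hmν : y.toRat = (M : ℚ) * ν := by rw [hyQ, hMdef, hQν]; push_cast; ring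
  have hGν : 2 ^ (v.expCode - 1) * φ.quantum = 2 * (2:ℚ) ^ g * ν := by
    rw [hDq, hQν, hgdef, pow_add]; ring
  have hMg : M = (2 * (V' : ℤ) + 1) * 2 ^ g := by
    have h1 : (M : ℚ) * ν = ((2 * (V' : ℤ) + 1) * 2 ^ g : ℤ) * ν := by
      rw [← hmν, hmid, hueq, hvQ, hV', hGν, hDq, hQν, hgdef]
      push_cast; ring
    exact_mod_cast mul_right_cancel₀ (ne_of_gt hν) h1
  -- the significand `V'` of the lower neighbour: `V' < 2^(m_φ+1)`
  have hV'nat : V' < 2 ^ (φ.manBits + 1) := by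
    have h1 := scaledMag_lt_pow_ulpExp v
    rw [hV', pow_add, mul_comm (2 ^ (φ.manBits + 1))] at h1
    exact Nat.lt_of_mul_lt_mul_left h1
  have hV'hi : (V' : ℤ) < 2 ^ (φ.manBits + 1) := by exact_mod_cast hV'nat
  -- (a) correct rounding in `ψ`: `|x - m| ≤ 2^t ν`
  set t := y.expCode - 1 with htdef
  have hyz : y.toRat < zM.toRat := by
    rw [hzM]; exact hyu.trans_le ((le_abs_self _).trans (abs_toRat_le_maxRat u))
  have habs : |x - y.toRat| ≤ 2 ^ t * ν := by
    have := abs_sub_roundNE_le_half_ulp_of_pos hy0 hyz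
    rw [← hydef, hQν] at this; convert this using 1; rw [htdef]; ring
  -- (b) `M < 2^(P_φ + g + 1)`
  have hMlt : M < (2:ℤ) ^ (φ.manBits + 1 + g + 1) := by
    have h1 : (M : ℚ) * ν < (2:ℚ) ^ (φ.manBits + 1 + g + 1) * ν := by
      rw [← hmν]
      calc y.toRat < u.toRat := hyu
        _ ≤ 2 ^ (φ.manBits + 1 + (v.expCode - 1)) * φ.quantum := hutop
        _ = (2:ℚ) ^ (φ.manBits + 1 + g + 1) * ν := by
            rw [hDq, hQν, hgdef]; simp only [pow_add, pow_one]; ring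
    exact_mod_cast lt_of_mul_lt_mul_right h1 hν.le
  -- (c) `2^t ≤ M` (for a subnormal midpoint `t = 0` and `M ≥ 2`)
  have hyS1 : 1 ≤ y.scaledMag := by
    by_contra h0
    have : y.scaledMag = 0 := by omega
    rw [hyQ, this] at hy0; simp at hy0
  have hMt : (2:ℤ) ^ t ≤ M := by
    rcases Nat.lt_or_ge y.expCode 1 with hE0 | hE1
    · have ht0 : t = 0 := by rw [htdef]; omega
      rw [ht0, pow_zero, hMdef]
      have : (1:ℤ) ≤ y.scaledMag := by exact_mod_cast hyS1
      linarith
    · have hSlo : 2 ^ (ψ.manBits + t) ≤ y.scaledMag := pow_le_scaledMag_of_expCode_pos y hE1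
      have h1 : ((2 ^ (ψ.manBits + t) : ℕ) : ℤ) ≤ y.scaledMag := by exact_mod_cast hSlo
      push_cast at h1
      rw [hMdef]
      have h2 : (2:ℤ) ^ t ≤ 2 ^ (ψ.manBits + t) := pow_le_pow_right₀ (by norm_num) (by omega)
      have h3 : (0:ℤ) ≤ y.scaledMag := by positivity
      linarith
  have hM0 : (0:ℤ) ≤ M := le_trans (by positivity) hMt
  -- (d) the operand: `a = Z ν²`, `Z = A₁ 2^κ`, `A₁ < 2^P_φ` odd
  have haS : a.scaledMag ≠ 0 := by
    intro h0; rw [toRat_eq_toInt_mul, toInt_eq_scaledMag_of_nonneg ha.le, h0] at ha; simp at ha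
  obtain ⟨α, A₁, hA₁, hAα, hA₁lt⟩ := exists_odd_part a haS
  set κ := α + D + 1 + W with hκdef
  set Z : ℤ := (A₁ : ℤ) * 2 ^ κ with hZdef
  have hZq : a.toRat = (Z : ℚ) * ν ^ 2 := by
    rw [toRat_eq_toInt_mul, toInt_eq_scaledMag_of_nonneg ha.le, hAα, hZdef, hκdef, hDq, hQν]
    push_cast
    calc ((2:ℚ) ^ α * A₁) * (2 ^ D * (2 * ν)) = 2 ^ α * A₁ * 2 ^ D * 2 * ν * (2 ^ W * ν) := by
          rw [hWν, mul_one]; ring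
      _ = A₁ * 2 ^ (α + D + 1 + W) * ν ^ 2 := by simp only [pow_add, pow_one]; ring
  have hA' : (A₁ : ℤ) < 2 ^ (φ.manBits + 1) := by exact_mod_cast hA₁lt
  -- (e) the surrogate pins `Z` against `M`
  have hlo : ((M : ℚ) - 2 ^ t) * ν ≤ x := by have := (abs_le.mp habs).1; rw [hmν] at this; linarith
  have hhi : x ≤ ((M : ℚ) + 2 ^ t) * ν := by have := (abs_le.mp habs).2; rw [hmν] at this; linarith
  have hMt' : (0:ℤ) ≤ M - 2 ^ t := by linarith
  have key : (M - 2 ^ t) ^ 2 ≤ Z ∧ Z ≤ (M + 2 ^ t) ^ 2 ∧ Z ≠ M ^ 2 := by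
    rcases hxn with ⟨hx1, hsq⟩ | ⟨hx1, hsqlo, hsqhi⟩
    · -- exact root `x = n ν`, `Z = n²`
      have hZn : Z = (n : ℤ) ^ 2 := by
        have e : ((n : ℚ) * ν) ^ 2 = ((n : ℤ) ^ 2 : ℤ) * ν ^ 2 := by push_cast; ring
        rw [hZq, e] at hsq
        exact_mod_cast (mul_right_cancel₀ (by positivity) hsq).symm
      have h1 : M - 2 ^ t ≤ (n : ℤ) := by
        have : ((M - 2 ^ t : ℤ) : ℚ) * ν ≤ (n : ℚ) * ν := by push_cast; rw [← hx1]; exact hlo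
        exact_mod_cast le_of_mul_le_mul_right this hν
      have h2 : (n : ℤ) ≤ M + 2 ^ t := by
        have : (n : ℚ) * ν ≤ ((M + 2 ^ t : ℤ) : ℚ) * ν := by push_cast; rw [← hx1]; exact hhi
        exact_mod_cast le_of_mul_le_mul_right this hν
      refine ⟨by rw [hZn]; exact pow_le_pow_left₀ hMt' h1 2,
        by rw [hZn]; exact pow_le_pow_left₀ (by positivity) h2 2, fun hZM => hxm ?_⟩
      have hnM : (n : ℤ) = M := by
        have := hZn.symm.trans hZM
        exact (pow_left_inj₀ (by positivity) hM0 two_ne_zero).mp this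
      rw [hx1, hmν, ← hnM]; norm_cast
    · -- midpoint `x = (n + ½) ν`, `n² < Z < (n+1)²`
      have hZlo' : (n : ℤ) ^ 2 < Z := by
        have : (((n : ℤ) ^ 2 : ℤ) : ℚ) * ν ^ 2 < (Z : ℚ) * ν ^ 2 := by
          rw [← hZq]; push_cast; rw [← mul_pow]; exact hsqlo
        exact_mod_cast lt_of_mul_lt_mul_right this (by positivity)
      have hZhi' : Z < ((n : ℤ) + 1) ^ 2 := by
        have : (Z : ℚ) * ν ^ 2 < ((((n : ℤ) + 1) ^ 2 : ℤ) : ℚ) * ν ^ 2 := by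
          rw [← hZq]; push_cast; rw [← mul_pow]; exact hsqhi
        exact_mod_cast lt_of_mul_lt_mul_right this (by positivity)
      have h1 : M - 2 ^ t ≤ (n : ℤ) := by
        by_contra hc
        have hc' : ((n : ℤ) : ℚ) + 1 ≤ ((M - 2 ^ t : ℤ) : ℚ) := by
          exact_mod_cast (show (n:ℤ) + 1 ≤ M - 2 ^ t by omega)
        push_cast at hc'
        rw [hx1] at hlo; have := mul_le_mul_of_nonneg_right hc' hν.le; linarith
      have h2 : (n : ℤ) + 1 ≤ M + 2 ^ t := by
        by_contra hc
        have hc' : ((M + 2 ^ t : ℤ) : ℚ) ≤ (n : ℚ) := by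
          exact_mod_cast (show M + 2 ^ t ≤ (n:ℤ) by omega)
        push_cast at hc'
        rw [hx1] at hhi; have := mul_le_mul_of_nonneg_right hc' hν.le; linarith
      refine ⟨(pow_le_pow_left₀ hMt' h1 2).trans hZlo'.le,
        hZhi'.le.trans (pow_le_pow_left₀ (by positivity) h2 2), fun hZM => ?_⟩
      rw [hZM] at hZlo' hZhi'
      have h3 : (n : ℤ) < M := lt_of_pow_lt_pow_left₀ 2 hM0 hZlo'
      have h4 : M < (n : ℤ) + 1 := lt_of_pow_lt_pow_left₀ 2 (by positivity) hZhi'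
      omega
  obtain ⟨hZlo, hZhi, hne⟩ := key
  -- (f) the midpoint `m = fl_ψ x` is subnormal in `ψ` (data returned), or normal (impossible)
  rcases Nat.lt_or_ge y.expCode 1 with hE0 | hE1
  · -- SUBNORMAL midpoint: `t = 0`
    have ht0 : t = 0 := by rw [htdef]; omega
    rw [ht0, pow_zero] at hZlo hZhi
    -- `4^g ∣ Z` in the form `sqrt_low_core` wants, and the binade bound `g ≤ m + 2`
    have hκV : 2 * g ≤ κ ∨ 2 ^ φ.manBits ≤ V' := by
      rcases Nat.lt_or_ge v.expCode 1 with hv0' | hv1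
      · left
        have : v.expCode - 1 = 0 := by omega
        rw [hgdef, hκdef, this]; omega
      · right
        have h1' := pow_le_scaledMag_of_expCode_pos v hv1
        rw [hV', pow_add, mul_comm (2 ^ φ.manBits)] at h1'
        exact Nat.le_of_mul_le_mul_left h1' (Nat.pos_of_ne_zero (by positivity))
    have hG := sqrt_low_core (m := φ.manBits) hA' hV'hi hMg hκV hZlo hZhi hne
    -- the size bound `κ ≤ 2m + 4 + 2g`: `2^κ ≤ Z ≤ (M+1)² ≤ 4^(m+2+g)`
    have hA1 : 1 ≤ A₁ := hA₁.pos
    have hκhi : κ ≤ 2 * φ.manBits + 4 + 2 * g := by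
      have h2 : (2:ℤ) ^ κ ≤ Z :=
        le_mul_of_one_le_left (by positivity) (by exact_mod_cast hA1)
      have h3 : M + 1 ≤ (2:ℤ) ^ (φ.manBits + 1 + g + 1) := hMlt
      have h4 : (M + 1) ^ 2 ≤ ((2:ℤ) ^ (φ.manBits + 1 + g + 1)) ^ 2 :=
        pow_le_pow_left₀ (by linarith) h3 2
      have he : (φ.manBits + 1 + g + 1) * 2 = 2 * φ.manBits + 4 + 2 * g := by omega
      have h5 : ((2:ℤ) ^ (φ.manBits + 1 + g + 1)) ^ 2 = 2 ^ (2 * φ.manBits + 4 + 2 * g) := by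
        rw [← pow_mul, he]
      have h6 : (2:ℤ) ^ κ ≤ 2 ^ (2 * φ.manBits + 4 + 2 * g) :=
        h5 ▸ (h2.trans (hZhi.trans h4))
      exact (pow_le_pow_iff_right₀ (by norm_num : (1:ℤ) < 2)).mp h6
    have hκlo : 2 * D + 1 + φ.bias + φ.manBits ≤ κ := by
      have hqφ : φ.qexp = 1 - (φ.bias : ℤ) - φ.manBits := rfl
      have : (κ : ℤ) = α + D + 1 + W := by rw [hκdef]; push_cast; ring
      omega
    refine ⟨g, V', A₁, κ, by rw [hgdef]; omega, hG, hV'nat, hA1, hA₁lt, hκlo, hκhi, ?_, ?_, ?_⟩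
    · rw [← hMg]; exact hZlo
    · rw [← hMg]; exact hZhi
    · rw [← hMg]; exact hne
  · -- NORMAL midpoint: the anatomy of THEOREM D-sqrt refutes it
    exfalso
    have hSlo : 2 ^ (ψ.manBits + t) ≤ y.scaledMag := pow_le_scaledMag_of_expCode_pos y hE1
    have hShi : y.scaledMag < 2 ^ (ψ.manBits + 1 + t) := scaledMag_lt_pow_ulpExp y
    obtain ⟨Y', hY'⟩ := pow_ulpExp_dvd_scaledMag y
    have hψ0 : ψ.manBits ≠ 0 := fun h0 => by rw [h0] at hm; exact Nat.not_succ_le_zero _ hm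
    obtain ⟨d, hd⟩ := Nat.exists_eq_succ_of_ne_zero hψ0
    have hMlo : (2:ℤ) ^ (d + t + 2) ≤ M := by
      have h1 : ((2 ^ (ψ.manBits + t) : ℕ) : ℤ) ≤ y.scaledMag := by exact_mod_cast hSlo
      push_cast at h1
      rw [hMdef, show d + t + 2 = (ψ.manBits + t) + 1 by omega, pow_succ]; linarith
    have hMhi : M < (2:ℤ) ^ (d + t + 3) := by
      have h1 : (y.scaledMag : ℤ) < ((2 ^ (ψ.manBits + 1 + t) : ℕ) : ℤ) := by exact_mod_cast hShi
      push_cast at h1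
      rw [hMdef, show d + t + 3 = (ψ.manBits + 1 + t) + 1 by omega, pow_succ]; linarith
    have hdvd : (2:ℤ) ^ (t + 1) ∣ M := ⟨Y', by rw [hMdef, hY', htdef, pow_succ]; push_cast; ring⟩
    exact sqrt_slip_core (P := φ.manBits + 1) (d := d) hA' (by omega) hMg hMlo hMhi hMlt hdvd
      hZlo hZhi hne

end Summit.Ventures.CertifiedArithmetic
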